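import Mathlib.Analysis.FunctionalSpaces.SobolevInequality
import Mathlib.MeasureTheory.Measure.Lebesgue.EqHaar
import Mathlib.Analysis.SpecialFunctions.Integrability.Basic
import Mathlib.Analysis.Calculus.ContDiff.Bounds
import Mathlib.Analysis.Calculus.BumpFunction.FiniteDimension
import HarnessLib

/-!
# The Sobolev imbedding `W^{2,2}(ℝ³) → C_B(ℝ³)` with its sup-norm bound (Adams)

Trunk: Sobolev (`Literature/Analysis/FunctionSpaces`). Proved results (no named facts): the
case `m = p = 2`, `n = 3`, `j = 0`, `Ω = ℝⁿ` of the Sobolev imbedding theorem, Part I Case C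
(`mp > n`: `W^{j+m,p}(Ω) → C_B^j(Ω)`), R. A. Adams, *Sobolev Spaces* (1975), Thm. 5.4 (p. 97 of
the text; = Adams–Fournier, 2nd ed. (2003), Thm. 4.12 Part I Case A), for `C²` functions and
with the imbedding constant explicit as a finite `ℝ≥0∞` number: on a real normed space `E` of
dimension `3` with a Haar measure `μ`,
`‖g(x)‖ ≤ K (‖g‖_{L²} + ‖Dg‖_{L²} + ‖D²g‖_{L²})` for every `C²` map `g : E → F` and every `x`
(`exists_enorm_le_sobolev_two_two_dim_three`). This is the form consumed by the fluid files
(`Literature.Analysis.FluidPDE.linfty_bound_of_hasBoundedSobolevNormsOn` in `FluidPDE/TaoLocalisation`): a velocity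
field with `C²` slices whose `L²` Sobolev norms up to order two are bounded uniformly in time is
bounded uniformly in space-time.

## The printed proof and this file

Adams proves Case C in Lemma 5.15 (pp. 97–98): if `p ≤ n < mp`, pick `j` with
`jp ≤ n < (j+1)p` and `r = np/(n - jp)`; then `|φ(x)| ≤ K₁ ‖φ‖_{1,r,C_x}` (the case `m = 1`,
`r > n`, Morrey's estimate: integrate `φ` radially over a cone with vertex `x` and use Hölder,
`∫ |x-y|^{-(n-1)r'} dy < ∞`) and `‖φ‖_{1,r} ≤ K ‖φ‖_{m,p}` (Lemma 5.14, resting on the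
Gagliardo–Nirenberg–Sobolev inequality Lemma 5.10). Here `m = p = 2`, `n = 3`, `j = 1`,
`r = 6`. The file follows this chain:

* `morrey_pointwise` — the `m = 1` step in any dimension `n < p`, in the segment/averaging
  form used in the proof of Lemma 5.17 (p. 99): `h(0) = h(z) - ∫₀¹ Dh(tz) z dt`, average over
  `z ∈ B₁`, substitute `w = tz` (Jacobian `t⁻ⁿ`, `Measure.map_addHaar_smul`), Hölder on `B_t`,
  `∫₀¹ t^{-n/p} dt < ∞`; result `μ(B₁)‖h(0)‖ ≤ ∫_{B₁}‖h‖ + K ‖Dh‖_{L^p}`, `K < ∞`.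
* the GNS step `‖Dh‖_{L⁶} ≤ K ‖D(Dh)‖_{L²}` for compactly supported `C²` maps in dimension `3`
  is Mathlib's `MeasureTheory.eLpNorm_le_eLpNorm_fderiv_of_eq` (`p = 2`, `p' = 6`,
  `1/6 = 1/2 - 1/3`) applied to `u = fderiv ℝ h`;
  `enorm_le_of_hasCompactSupport_dim_three` assembles the compactly supported case.
* `exists_enorm_le_sobolev_two_two_dim_three` removes the support hypothesis by translation and
  a fixed smooth cutoff (`ContDiffBump`, Leibniz bound `norm_iteratedFDeriv_smul_le`), which
  is where the full `W^{2,2}` norm (orders `0, 1, 2`) enters, as in `‖φ‖_{2,2}`.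

No density/a.e.-representative argument is needed since only `C²` functions are treated (Adams'
(25), the heart of Lemma 5.15, is exactly the smooth case).

## Mathlib search

Mathlib (this pin) has the GNS inequality (`Mathlib/Analysis/FunctionalSpaces/SobolevInequality`)
and Bessel-potential Sobolev classes with the qualitative `MemSobolev.fourier_memL1`
(`Mathlib/Analysis/Distribution/Sobolev`), but no Morrey inequality and no imbedding into
bounded/continuous functions with a norm bound (`lean search 'Morrey'`: none). Nothing is
defined here; all constants are existentially quantified finite `ℝ≥0∞` numbers.

## References

* R. A. Adams, *Sobolev Spaces*, Pure and Applied Mathematics 65, Academic Press (1975):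
  Thm. 5.4 (the Sobolev imbedding theorem) Part I Case C; Lemmas 5.10, 5.14, 5.15, 5.17
  (pp. 95–99). [held: `book:adams2003-sobolev-spaces-2nd-ed` is this first-edition text]
* R. A. Adams, J. J. F. Fournier, *Sobolev Spaces*, 2nd ed., Academic Press (2003), Thm. 4.12
  Part I Case A.
-/

noncomputable section

open MeasureTheory Metric Set Filter Topology Module
open scoped ENNReal NNReal ContDiff

namespace Literature.Analysis.FunctionSpaces

variable {E : Type*} [NormedAddCommGroup E] [NormedSpace ℝ E]
variable {F : Type*} [NormedAddCommGroup F] [NormedSpace ℝ F]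

/-- Integration along the segment `[0, z]`: for a `C¹` map `h`,
`‖h 0‖ ≤ ‖h z‖ + ∫₀¹ ‖Dh(t z)‖ ‖z‖ dt`, in `ℝ≥0∞` form. [folklore] -/
theorem enorm_apply_zero_le_add_lintegral_fderiv_segment [CompleteSpace F] {h : E → F}
    (hh : ContDiff ℝ 1 h)
    (z : E) :
    ‖h 0‖ₑ ≤ ‖h z‖ₑ + ∫⁻ t in Ioc (0 : ℝ) 1, ‖fderiv ℝ h (t • z)‖ₑ * ‖z‖ₑ := by
  -- derivative of `t ↦ h (t • z)`
  have hderiv : ∀ t : ℝ, HasDerivAt (fun s : ℝ => h (s • z)) (fderiv ℝ h (t • z) z) t := by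
    intro t
    have h1 : HasDerivAt (fun s : ℝ => s • z) ((1 : ℝ) • z) t := (hasDerivAt_id t).smul_const z
    rw [one_smul] at h1
    exact ((hh.differentiable one_ne_zero (t • z)).hasFDerivAt).comp_hasDerivAt t h1
  have hcont : Continuous fun t : ℝ => fderiv ℝ h (t • z) z :=
    ((hh.continuous_fderiv one_ne_zero).comp (continuous_id.smul continuous_const)).clm_apply
      continuous_const
  have hcont' : Continuous fun t : ℝ => ‖fderiv ℝ h (t • z)‖ * ‖z‖ :=
    ((hh.continuous_fderiv one_ne_zero).comp (continuous_id.smul continuous_const)).norm.mul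
      continuous_const
  have hFTC : ∫ t in (0 : ℝ)..1, fderiv ℝ h (t • z) z = h ((1 : ℝ) • z) - h ((0 : ℝ) • z) :=
    intervalIntegral.integral_eq_sub_of_hasDerivAt (fun t _ => hderiv t)
      (hcont.intervalIntegrable _ _)
  rw [one_smul, zero_smul] at hFTC
  -- real inequality
  have hreal : ‖h 0‖ ≤ ‖h z‖ + ∫ t in (0 : ℝ)..1, ‖fderiv ℝ h (t • z)‖ * ‖z‖ := by
    have h0 : h 0 = h z - ∫ t in (0 : ℝ)..1, fderiv ℝ h (t • z) z := by rw [hFTC]; abel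
    calc ‖h 0‖ = ‖h z - ∫ t in (0 : ℝ)..1, fderiv ℝ h (t • z) z‖ := by rw [h0]
      _ ≤ ‖h z‖ + ‖∫ t in (0 : ℝ)..1, fderiv ℝ h (t • z) z‖ := norm_sub_le _ _
      _ ≤ ‖h z‖ + ∫ t in (0 : ℝ)..1, ‖fderiv ℝ h (t • z) z‖ := by
          gcongr; exact intervalIntegral.norm_integral_le_integral_norm zero_le_one
      _ ≤ ‖h z‖ + ∫ t in (0 : ℝ)..1, ‖fderiv ℝ h (t • z)‖ * ‖z‖ := by
          gcongr
          exact intervalIntegral.integral_mono_on zero_le_one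
            (hcont.norm.intervalIntegrable _ _) (hcont'.intervalIntegrable _ _)
            fun t _ => ContinuousLinearMap.le_opNorm _ _
  -- pass to `ℝ≥0∞`
  have hI : ENNReal.ofReal (∫ t in (0 : ℝ)..1, ‖fderiv ℝ h (t • z)‖ * ‖z‖) =
      ∫⁻ t in Ioc (0 : ℝ) 1, ‖fderiv ℝ h (t • z)‖ₑ * ‖z‖ₑ := by
    rw [intervalIntegral.integral_of_le zero_le_one,
      ofReal_integral_eq_lintegral_ofReal (hcont'.integrableOn_Icc.mono_set Ioc_subset_Icc_self)
        (Eventually.of_forall fun t => by positivity)]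
    refine lintegral_congr fun t => ?_
    rw [ENNReal.ofReal_mul (norm_nonneg _), ofReal_norm, ofReal_norm]
  calc ‖h 0‖ₑ = ENNReal.ofReal ‖h 0‖ := (ofReal_norm _).symm
    _ ≤ ENNReal.ofReal (‖h z‖ + ∫ t in (0 : ℝ)..1, ‖fderiv ℝ h (t • z)‖ * ‖z‖) :=
        ENNReal.ofReal_le_ofReal hreal
    _ = ‖h z‖ₑ + ∫⁻ t in Ioc (0 : ℝ) 1, ‖fderiv ℝ h (t • z)‖ₑ * ‖z‖ₑ := by
        rw [ENNReal.ofReal_add (norm_nonneg _)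
          (intervalIntegral.integral_nonneg zero_le_one fun t _ => by positivity),
          ofReal_norm, hI]

/-! ### Morrey's pointwise inequality (Adams 1975, Lemma 5.15 case `m = 1`; Lemma 5.17) -/

section Morrey

variable [MeasurableSpace E] [BorelSpace E] [FiniteDimensional ℝ E] (μ : Measure E)
  [μ.IsAddHaarMeasure]

/-- The weight integral of Morrey's inequality is finite for `p > n`:
`∫₀¹ t^{-n} (t^n)^{1-1/p} dt = ∫₀¹ t^{-n/p} dt < ∞`. [folklore] -/
theorem lintegral_morrey_weight_lt_top {n : ℕ} {p : ℝ≥0} (hp1 : 1 ≤ p) (hp : (n : ℝ) < p) :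
    ∫⁻ t in Ioc (0 : ℝ) 1, ENNReal.ofReal ((t ^ n)⁻¹ * (t ^ n) ^ (1 - (p : ℝ)⁻¹)) < ⊤ := by
  have hp0 : 0 < (p : ℝ) := lt_of_lt_of_le zero_lt_one (by exact_mod_cast hp1)
  set r : ℝ := -((n : ℝ) / p) with hr
  have hr1 : -1 < r := by
    rw [hr, neg_lt_neg_iff, div_lt_one hp0]; exact hp
  -- the integrand equals `t ^ r` on `(0, 1]`
  have hcongr : ∀ t ∈ Ioc (0 : ℝ) 1, ENNReal.ofReal ((t ^ n)⁻¹ * (t ^ n) ^ (1 - (p : ℝ)⁻¹)) =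
      ‖t ^ r‖ₑ := by
    intro t ht
    have ht0 : 0 < t := ht.1
    rw [Real.enorm_eq_ofReal (Real.rpow_nonneg ht0.le _)]
    congr 1
    rw [← Real.rpow_natCast_mul ht0.le, ← Real.rpow_natCast, ← Real.rpow_neg ht0.le,
      ← Real.rpow_add ht0, hr]
    congr 1
    field_simp
    ring
  rw [setLIntegral_congr_fun measurableSet_Ioc hcongr]
  have hint : IntegrableOn (fun t : ℝ => t ^ r) (Ioc 0 1) volume :=
    (intervalIntegral.intervalIntegrable_rpow' hr1 (a := 0) (b := 1)).1
  exact hint.2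

/-- **Morrey's pointwise inequality** (the `m = 1` step of Adams, *Sobolev Spaces* (1975),
Lemma 5.15, in the segment/averaging form of the proof of Lemma 5.17, p. 99): on a real normed
space `E` of dimension `n` with a Haar measure `μ`, for `p ≥ 1`, `p > n`, there is a finite
constant `K` (namely `μ(B₁)^{1-1/p} ∫₀¹ t^{-n/p} dt`, depending only on `E, μ, p`) such that
every `C¹` map `h` satisfies `μ(B₁) ‖h(0)‖ ≤ ∫_{B₁} ‖h‖ dμ + K ‖Dh‖_{L^p(μ)}`, `B₁` the unit
ball. Proof as printed: `h(0) = h(z) - ∫₀¹ Dh(tz) z dt`, integrate over `z ∈ B₁`, substitute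
`w = tz` (Jacobian `t⁻ⁿ`), Hölder on `B_t`, and `∫₀¹ t^{-n/p} dt < ∞`. [cite: Adams1975, Lemma 5.15 (case m = 1), proof of Lemma 5.17] -/
theorem morrey_pointwise [CompleteSpace F] {p : ℝ≥0} (hp1 : 1 ≤ p)
    (hp : (finrank ℝ E : ℝ) < p) :
    ∃ K : ℝ≥0∞, K < ⊤ ∧ ∀ ⦃h : E → F⦄, ContDiff ℝ 1 h →
      μ (ball (0 : E) 1) * ‖h 0‖ₑ ≤
        ∫⁻ z in ball (0 : E) 1, ‖h z‖ₑ ∂μ + K * eLpNorm (fderiv ℝ h) p μ := by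
  refine ⟨μ (ball (0 : E) 1) ^ (1 - (p : ℝ)⁻¹) *
    ∫⁻ t in Ioc (0 : ℝ) 1, ENNReal.ofReal ((t ^ finrank ℝ E)⁻¹ *
      (t ^ finrank ℝ E) ^ (1 - (p : ℝ)⁻¹)), ?_, fun h hh => ?_⟩
  · refine ENNReal.mul_lt_top (ENNReal.rpow_lt_top_of_nonneg ?_ measure_ball_lt_top.ne)
      (lintegral_morrey_weight_lt_top hp1 hp)
    rw [sub_nonneg]; exact inv_le_one_of_one_le₀ (by exact_mod_cast hp1)
  set B := ball (0 : E) 1 with hB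
  set n := finrank ℝ E
  set a : ℝ := 1 - (p : ℝ)⁻¹ with ha
  have ha0 : 0 ≤ a := by
    rw [ha, sub_nonneg]; exact inv_le_one_of_one_le₀ (by exact_mod_cast hp1)
  set N := eLpNorm (fderiv ℝ h) p μ
  have hDcont : Continuous (fderiv ℝ h) := hh.continuous_fderiv one_ne_zero
  -- Step 1: integrate the segment inequality over `B`
  have h1 : μ B * ‖h 0‖ₑ ≤ (∫⁻ z in B, ‖h z‖ₑ ∂μ) +
      ∫⁻ z in B, ∫⁻ t in Ioc (0 : ℝ) 1, ‖fderiv ℝ h (t • z)‖ₑ ∂volume ∂μ := by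
    calc μ B * ‖h 0‖ₑ = ∫⁻ _ in B, ‖h 0‖ₑ ∂μ := by rw [setLIntegral_const, mul_comm]
      _ ≤ ∫⁻ z in B, (‖h z‖ₑ + ∫⁻ t in Ioc (0 : ℝ) 1, ‖fderiv ℝ h (t • z)‖ₑ ∂volume) ∂μ := by
          refine setLIntegral_mono' measurableSet_ball fun z hz => ?_
          refine (enorm_apply_zero_le_add_lintegral_fderiv_segment hh z).trans ?_
          have hz1 : ‖z‖ₑ ≤ 1 := by
            rw [← ofReal_norm]; exact ENNReal.ofReal_le_one.2 (mem_ball_zero_iff.1 hz).le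
          gcongr with t
          calc ‖fderiv ℝ h (t • z)‖ₑ * ‖z‖ₑ ≤ ‖fderiv ℝ h (t • z)‖ₑ * 1 := by gcongr
            _ = _ := mul_one _
      _ = _ := lintegral_add_left (continuous_enorm.comp hh.continuous).measurable _
  -- Step 2: Tonelli
  have h2 : ∫⁻ z in B, ∫⁻ t in Ioc (0 : ℝ) 1, ‖fderiv ℝ h (t • z)‖ₑ ∂volume ∂μ =
      ∫⁻ t in Ioc (0 : ℝ) 1, ∫⁻ z in B, ‖fderiv ℝ h (t • z)‖ₑ ∂μ ∂volume := by
    apply lintegral_lintegral_swap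
    have : Continuous fun q : E × ℝ => ‖fderiv ℝ h (q.2 • q.1)‖ₑ :=
      (hDcont.comp (continuous_snd.smul continuous_fst)).enorm
    exact this.measurable.aemeasurable
  -- Step 3: change of variables + Hölder for fixed `t ∈ (0, 1]`
  have h3 : ∀ t ∈ Ioc (0 : ℝ) 1, ∫⁻ z in B, ‖fderiv ℝ h (t • z)‖ₑ ∂μ ≤
      N * μ B ^ a * ENNReal.ofReal ((t ^ n)⁻¹ * (t ^ n) ^ a) := by
    intro t ht
    have ht0 : 0 < t := ht.1
    set G : E → ℝ≥0∞ := (ball (0 : E) t).indicator fun w => ‖fderiv ℝ h w‖ₑ with hG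
    have hGm : Measurable G :=
      (continuous_enorm.comp hDcont).measurable.indicator measurableSet_ball
    have hmem : ∀ z : E, t • z ∈ ball (0 : E) t ↔ z ∈ B := by
      intro z
      rw [mem_ball_zero_iff, hB, mem_ball_zero_iff, norm_smul, Real.norm_of_nonneg ht0.le]
      constructor
      · intro hlt; exact (mul_lt_iff_lt_one_right ht0).1 hlt
      · intro hlt; exact (mul_lt_iff_lt_one_right ht0).2 hlt
    have hHolder : ∫⁻ w in ball (0 : E) t, ‖fderiv ℝ h w‖ₑ ∂μ ≤ N * μ (ball (0 : E) t) ^ a := by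
      calc ∫⁻ w in ball (0 : E) t, ‖fderiv ℝ h w‖ₑ ∂μ
          = eLpNorm (fderiv ℝ h) 1 (μ.restrict (ball (0 : E) t)) :=
            eLpNorm_one_eq_lintegral_enorm.symm
        _ ≤ eLpNorm (fderiv ℝ h) p (μ.restrict (ball (0 : E) t)) *
              (μ.restrict (ball (0 : E) t)) univ ^
                (1 / (1 : ℝ≥0∞).toReal - 1 / ((p : ℝ≥0∞)).toReal) :=
            eLpNorm_le_eLpNorm_mul_rpow_measure_univ (by exact_mod_cast hp1)
              hDcont.aestronglyMeasurable
        _ ≤ N * μ (ball (0 : E) t) ^ a := by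
            rw [Measure.restrict_apply_univ]
            have hexp : 1 / (1 : ℝ≥0∞).toReal - 1 / ((p : ℝ≥0∞)).toReal = a := by
              simp [ha]
            rw [hexp]
            gcongr
            exact eLpNorm_restrict_le _ _ _ _
    calc ∫⁻ z in B, ‖fderiv ℝ h (t • z)‖ₑ ∂μ
        = ∫⁻ z, B.indicator (fun z => ‖fderiv ℝ h (t • z)‖ₑ) z ∂μ :=
          (lintegral_indicator measurableSet_ball _).symm
      _ = ∫⁻ z, G (t • z) ∂μ := by
          refine lintegral_congr fun z => ?_
          by_cases hz : z ∈ B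
          · rw [indicator_of_mem hz, hG, indicator_of_mem ((hmem z).2 hz)]
          · rw [indicator_of_notMem hz, hG, indicator_of_notMem (fun h' => hz ((hmem z).1 h'))]
      _ = ∫⁻ w, G w ∂(Measure.map (fun z : E => t • z) μ) :=
          (lintegral_map hGm (measurable_const_smul t)).symm
      _ = ENNReal.ofReal (|(t ^ n)⁻¹|) * ∫⁻ w in ball (0 : E) t, ‖fderiv ℝ h w‖ₑ ∂μ := by
          rw [Measure.map_addHaar_smul μ ht0.ne', lintegral_smul_measure, hG,
            lintegral_indicator measurableSet_ball, smul_eq_mul]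
      _ ≤ ENNReal.ofReal ((t ^ n)⁻¹) * (N * μ (ball (0 : E) t) ^ a) := by
          rw [abs_of_nonneg (by positivity)]
          gcongr
      _ = N * μ B ^ a * ENNReal.ofReal ((t ^ n)⁻¹ * (t ^ n) ^ a) := by
          rw [Measure.addHaar_ball_of_pos μ (0 : E) ht0, ENNReal.mul_rpow_of_nonneg _ _ ha0,
            ENNReal.ofReal_rpow_of_pos (pow_pos ht0 n),
            ENNReal.ofReal_mul (inv_nonneg.2 (pow_nonneg ht0.le n))]
          ring
  -- Step 4: integrate in `t`
  have h4 : ∫⁻ t in Ioc (0 : ℝ) 1, ∫⁻ z in B, ‖fderiv ℝ h (t • z)‖ₑ ∂μ ∂volume ≤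
      (μ B ^ a * ∫⁻ t in Ioc (0 : ℝ) 1, ENNReal.ofReal ((t ^ n)⁻¹ * (t ^ n) ^ a)) * N := by
    calc ∫⁻ t in Ioc (0 : ℝ) 1, ∫⁻ z in B, ‖fderiv ℝ h (t • z)‖ₑ ∂μ ∂volume
        ≤ ∫⁻ t in Ioc (0 : ℝ) 1, N * μ B ^ a * ENNReal.ofReal ((t ^ n)⁻¹ * (t ^ n) ^ a)
            ∂volume := setLIntegral_mono' measurableSet_Ioc h3
      _ = N * μ B ^ a * ∫⁻ t in Ioc (0 : ℝ) 1, ENNReal.ofReal ((t ^ n)⁻¹ * (t ^ n) ^ a)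
            ∂volume := by
          refine lintegral_const_mul _ ?_
          refine Measurable.ennreal_ofReal ?_
          exact ((measurable_id.pow_const n).inv).mul ((measurable_id.pow_const n).pow_const a)
      _ = _ := by ring
  calc μ B * ‖h 0‖ₑ ≤ (∫⁻ z in B, ‖h z‖ₑ ∂μ) +
        ∫⁻ z in B, ∫⁻ t in Ioc (0 : ℝ) 1, ‖fderiv ℝ h (t • z)‖ₑ ∂volume ∂μ := h1
    _ ≤ (∫⁻ z in B, ‖h z‖ₑ ∂μ) +
        (μ B ^ a * ∫⁻ t in Ioc (0 : ℝ) 1, ENNReal.ofReal ((t ^ n)⁻¹ * (t ^ n) ^ a)) * N := by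
          rw [h2]; gcongr

end Morrey

/-! ### `W^{2,2} → C_B` in dimension three (Adams 1975, Lemma 5.15, `m = p = 2`, `n = 3`) -/

section DimThree

variable [MeasurableSpace E] [BorelSpace E] [FiniteDimensional ℝ E] (μ : Measure E)
  [μ.IsAddHaarMeasure] [FiniteDimensional ℝ F]

omit [NormedSpace ℝ E] [FiniteDimensional ℝ E] in
/-- Translation invariance of `L^p` norms for a Haar measure. [folklore] -/
theorem eLpNorm_comp_add_right {G : Type*} [NormedAddCommGroup G] (f : E → G) (x : E)
    {p : ℝ≥0∞} (hp0 : p ≠ 0) (hp : p ≠ ⊤) :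
    eLpNorm (fun y => f (y + x)) p μ = eLpNorm f p μ := by
  rw [eLpNorm_eq_lintegral_rpow_enorm_toReal hp0 hp,
    eLpNorm_eq_lintegral_rpow_enorm_toReal hp0 hp,
    lintegral_add_right_eq_self (μ := μ) (fun y => ‖f y‖ₑ ^ p.toReal) x]

omit [MeasurableSpace E] [BorelSpace E] [FiniteDimensional ℝ E] [FiniteDimensional ℝ F] in
/-- `‖D(Dh)(x)‖ = ‖D²h(x)‖` (curried vs. uncurried second derivative). [folklore] -/
theorem norm_fderiv_fderiv_eq_norm_iteratedFDeriv_two (h : E → F) (x : E) :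
    ‖fderiv ℝ (fderiv ℝ h) x‖ = ‖iteratedFDeriv ℝ 2 h x‖ := by
  rw [← norm_iteratedFDeriv_fderiv (n := 1), ← norm_iteratedFDeriv_fderiv (n := 0),
    norm_iteratedFDeriv_zero]

/-- **`W^{2,2}(ℝ³) → C_B(ℝ³)`, compactly supported case** (Adams, *Sobolev Spaces* (1975),
Lemma 5.15 with `m = p = 2`, `n = 3`: `p ≤ n < mp`, `j = 1`, `r = np/(n - jp) = 6`): for a `C²`
map `h` with compact support on a `3`-dimensional real normed space,
`‖h(0)‖ ≤ K (‖h‖_{L²} + ‖D²h‖_{L²})` with a finite `K` depending only on `E, F, μ`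
(`K = μ(B₁)⁻¹ (μ(B₁)^{1/2} + K_Morrey(6) K_GNS(2))`).
Printed chain: Morrey (`morrey_pointwise`, `r = 6 > 3 = n`) and the Gagliardo–Nirenberg–Sobolev
inequality `‖Dh‖_{L⁶} ≤ K ‖D(Dh)‖_{L²}` (Lemmas 5.14/5.10; Mathlib
`MeasureTheory.eLpNorm_le_eLpNorm_fderiv_of_eq`), plus `‖h‖_{L¹(B₁)} ≤ μ(B₁)^{1/2}‖h‖_{L²}`
(Hölder). [cite: Adams1975, Lemma 5.15 (p ≤ n < mp)] -/
theorem enorm_le_of_hasCompactSupport_dim_three (hE : finrank ℝ E = 3) :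
    ∃ K : ℝ≥0∞, K < ⊤ ∧ ∀ ⦃h : E → F⦄, ContDiff ℝ 2 h → HasCompactSupport h →
      ‖h 0‖ₑ ≤ K * (eLpNorm h 2 μ + eLpNorm (iteratedFDeriv ℝ 2 h) 2 μ) := by
  haveI : CompleteSpace F := FiniteDimensional.complete ℝ F
  set B := ball (0 : E) 1 with hB
  set V := μ B
  have hV0 : V ≠ 0 := (measure_ball_pos μ (0 : E) one_pos).ne'
  have hVtop : V ≠ ⊤ := measure_ball_lt_top.ne
  -- Morrey with `p = 6 > 3`
  obtain ⟨Kₘ, hKₘ, hMorrey⟩ :=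
    morrey_pointwise μ (F := F) (p := 6) (by norm_num) (by rw [hE]; norm_num)
  refine ⟨V⁻¹ * (V ^ (1 / 2 : ℝ) + Kₘ * SNormLESNormFDerivOfEqConst (E →L[ℝ] F) μ 2), ?_,
    fun h hh hsupp => ?_⟩
  · refine ENNReal.mul_lt_top (ENNReal.inv_lt_top.2 (measure_ball_pos μ (0 : E) one_pos)) ?_
    exact ENNReal.add_lt_top.2 ⟨ENNReal.rpow_lt_top_of_nonneg (by norm_num) hVtop,
      ENNReal.mul_lt_top hKₘ ENNReal.coe_lt_top⟩
  have hM := hMorrey (hh.of_le one_le_two)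
  -- Gagliardo–Nirenberg–Sobolev for `Dh`
  have hD1 : ContDiff ℝ 1 (fderiv ℝ h) := hh.fderiv_right (m := 1) (by norm_num)
  have hGNS : eLpNorm (fderiv ℝ h) 6 μ ≤ SNormLESNormFDerivOfEqConst (E →L[ℝ] F) μ 2 *
      eLpNorm (fderiv ℝ (fderiv ℝ h)) 2 μ := by
    have := eLpNorm_le_eLpNorm_fderiv_of_eq μ hD1 (hsupp.fderiv ℝ) (p := 2) (p' := 6)
      (by norm_num) (by rw [hE]; norm_num) (by rw [hE]; push_cast; norm_num)
    simpa only [ENNReal.coe_ofNat, NNReal.coe_ofNat] using this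
  have hD2 : eLpNorm (fderiv ℝ (fderiv ℝ h)) 2 μ = eLpNorm (iteratedFDeriv ℝ 2 h) 2 μ := by
    rw [← eLpNorm_norm (fderiv ℝ (fderiv ℝ h)), ← eLpNorm_norm (iteratedFDeriv ℝ 2 h)]
    simp_rw [norm_fderiv_fderiv_eq_norm_iteratedFDeriv_two]
  rw [hD2] at hGNS
  -- `L¹(B) ≤ L²`
  have hL1 : ∫⁻ z in B, ‖h z‖ₑ ∂μ ≤ eLpNorm h 2 μ * V ^ (1 / 2 : ℝ) := by
    calc ∫⁻ z in B, ‖h z‖ₑ ∂μ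
        = eLpNorm h 1 (μ.restrict B) := eLpNorm_one_eq_lintegral_enorm.symm
      _ ≤ eLpNorm h 2 (μ.restrict B) *
            (μ.restrict B) univ ^ (1 / (1 : ℝ≥0∞).toReal - 1 / (2 : ℝ≥0∞).toReal) :=
          eLpNorm_le_eLpNorm_mul_rpow_measure_univ (by norm_num)
            hh.continuous.aestronglyMeasurable
      _ ≤ eLpNorm h 2 μ * V ^ (1 / 2 : ℝ) := by
          rw [Measure.restrict_apply_univ]
          have hexp : 1 / (1 : ℝ≥0∞).toReal - 1 / (2 : ℝ≥0∞).toReal = 1 / 2 := by norm_num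
          rw [hexp]
          gcongr
          exact Measure.restrict_le_self
  -- combine
  have hcomb : V * ‖h 0‖ₑ ≤ (V ^ (1 / 2 : ℝ) +
      Kₘ * SNormLESNormFDerivOfEqConst (E →L[ℝ] F) μ 2) *
        (eLpNorm h 2 μ + eLpNorm (iteratedFDeriv ℝ 2 h) 2 μ) := by
    calc V * ‖h 0‖ₑ
        ≤ (∫⁻ z in B, ‖h z‖ₑ ∂μ) + Kₘ * eLpNorm (fderiv ℝ h) 6 μ := hM
      _ ≤ eLpNorm h 2 μ * V ^ (1 / 2 : ℝ) + Kₘ *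
            (SNormLESNormFDerivOfEqConst (E →L[ℝ] F) μ 2 *
              eLpNorm (iteratedFDeriv ℝ 2 h) 2 μ) := by gcongr
      _ = V ^ (1 / 2 : ℝ) * eLpNorm h 2 μ + (Kₘ *
            SNormLESNormFDerivOfEqConst (E →L[ℝ] F) μ 2) *
              eLpNorm (iteratedFDeriv ℝ 2 h) 2 μ := by
          ring
      _ ≤ (V ^ (1 / 2 : ℝ) * eLpNorm h 2 μ +
              V ^ (1 / 2 : ℝ) * eLpNorm (iteratedFDeriv ℝ 2 h) 2 μ) +
            ((Kₘ * SNormLESNormFDerivOfEqConst (E →L[ℝ] F) μ 2) * eLpNorm h 2 μ +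
            (Kₘ * SNormLESNormFDerivOfEqConst (E →L[ℝ] F) μ 2) *
              eLpNorm (iteratedFDeriv ℝ 2 h) 2 μ) :=
          add_le_add le_self_add le_add_self
      _ = _ := by ring
  calc ‖h 0‖ₑ = V⁻¹ * (V * ‖h 0‖ₑ) := by
        rw [← mul_assoc, ENNReal.inv_mul_cancel hV0 hVtop, one_mul]
    _ ≤ V⁻¹ * ((V ^ (1 / 2 : ℝ) + Kₘ * SNormLESNormFDerivOfEqConst (E →L[ℝ] F) μ 2) *
          (eLpNorm h 2 μ + eLpNorm (iteratedFDeriv ℝ 2 h) 2 μ)) := by gcongr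
    _ = _ := by rw [mul_assoc]

/-- **The Sobolev imbedding `W^{2,2}(ℝ³) → C_B(ℝ³)` with its sup-norm bound** (Adams,
*Sobolev Spaces* (1975), Thm. 5.4 Part I Case C: "Suppose `mp > n`. Then
`W^{j+m,p}(Ω) → C_B^j(Ω)`", with `m = p = 2`, `n = 3`, `j = 0`, `Ω = ℝⁿ`, imbedding constant
as in §5.3; = Adams–Fournier (2003) Thm. 4.12 Part I Case A; proof: Lemma 5.15), for `C²`
functions, where no passage to a.e.-representatives is needed: on a real normed space `E` of
dimension `3` with a Haar measure `μ` there is a finite constant `K` such that every `C²` map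
`g : E → F` satisfies `‖g(x)‖ ≤ K (‖g‖_{L²} + ‖Dg‖_{L²} + ‖D²g‖_{L²})` for all `x` (the
right side may be `∞`). Reduction to the compactly supported case
(`enorm_le_of_hasCompactSupport_dim_three`) by translation and a fixed smooth cutoff `φ`
(`= 1` near `0`), using Leibniz' bound `‖D²(φg)‖ ≤ Σ C(2,i) ‖Dⁱφ‖ ‖D^{2-i}g‖`. [cite: Adams1975, Thm. 5.4 Part I Case C (mp > n) and Lemma 5.15] -/
theorem exists_enorm_le_sobolev_two_two_dim_three (hE : finrank ℝ E = 3) :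
    ∃ K : ℝ≥0∞, K < ⊤ ∧ ∀ (g : E → F), ContDiff ℝ 2 g → ∀ x : E,
      ‖g x‖ₑ ≤ K * ∑ j ∈ Finset.range 3, eLpNorm (iteratedFDeriv ℝ j g) 2 μ := by
  -- a fixed cutoff
  let φ : ContDiffBump (0 : E) := ⟨1, 2, one_pos, one_lt_two⟩
  -- uniform bounds on `Dⁱφ`, `i ≤ 2`
  have hbd : ∀ i : ℕ, ∃ A : ℝ, ∀ y, ‖iteratedFDeriv ℝ i φ y‖ ≤ A := fun i =>
    (φ.contDiff.continuous_iteratedFDeriv (m := i)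
      (by exact_mod_cast le_top)).bounded_above_of_compact_support
        (φ.hasCompactSupport.iteratedFDeriv i)
  choose A hA using hbd
  set A' : ℝ := max (max (A 0) (A 1)) (max (A 2) 0) with hA'
  have hA'0 : 0 ≤ A' := le_max_of_le_right (le_max_right _ _)
  have hAi : ∀ i ∈ Finset.range 3, ∀ y, ‖iteratedFDeriv ℝ i φ y‖ ≤ A' := by
    intro i hi y
    have hi' : i = 0 ∨ i = 1 ∨ i = 2 := by
      have := Finset.mem_range.1 hi; omega
    rcases hi' with rfl | rfl | rfl
    · exact (hA 0 y).trans (le_max_of_le_left (le_max_left _ _))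
    · exact (hA 1 y).trans (le_max_of_le_left (le_max_right _ _))
    · exact (hA 2 y).trans (le_max_of_le_right (le_max_left _ _))
  obtain ⟨K₂, hK₂, hcpt⟩ := enorm_le_of_hasCompactSupport_dim_three μ (F := F) hE
  refine ⟨K₂ * (1 + ENNReal.ofReal (2 * A')), ENNReal.mul_lt_top hK₂
      (ENNReal.add_lt_top.2 ⟨ENNReal.one_lt_top, ENNReal.ofReal_lt_top⟩), fun g hg x => ?_⟩
  -- translate and cut off
  set g' : E → F := fun y => g (y + x) with hg'
  have hg'c : ContDiff ℝ 2 g' := hg.comp ((contDiff_id).add contDiff_const)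
  set h : E → F := fun y => φ y • g' y with hh
  have hhc : ContDiff ℝ 2 h := (φ.contDiff (n := 2)).smul hg'c
  have hhs : HasCompactSupport h := φ.hasCompactSupport.smul_right
  have h0 : h 0 = g x := by
    simp only [hh, hg', zero_add]
    rw [φ.one_of_mem_closedBall (mem_closedBall_self φ.rIn_pos.le), one_smul]
  have hmain := hcpt hhc hhs
  rw [h0] at hmain
  -- the Sobolev norms of `g'` are those of `g`
  have hnorm : ∀ j : ℕ,
      eLpNorm (iteratedFDeriv ℝ j g') 2 μ = eLpNorm (iteratedFDeriv ℝ j g) 2 μ := by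
    intro j
    rw [hg', iteratedFDeriv_comp_add_right' j x]
    exact eLpNorm_comp_add_right μ (iteratedFDeriv ℝ j g) x two_ne_zero ENNReal.ofNat_ne_top
  set S := ∑ j ∈ Finset.range 3, eLpNorm (iteratedFDeriv ℝ j g) 2 μ with hS
  -- `‖h‖₂ ≤ ‖g‖₂ ≤ S`
  have hL2 : eLpNorm h 2 μ ≤ S := by
    calc eLpNorm h 2 μ ≤ eLpNorm g' 2 μ := by
          refine eLpNorm_mono fun y => ?_
          rw [hh]; dsimp only
          rw [norm_smul, Real.norm_of_nonneg φ.nonneg]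
          exact mul_le_of_le_one_left (norm_nonneg _) φ.le_one
      _ = eLpNorm (iteratedFDeriv ℝ 0 g') 2 μ := by
          rw [← eLpNorm_norm g', ← eLpNorm_norm (iteratedFDeriv ℝ 0 g')]
          simp_rw [norm_iteratedFDeriv_zero]
      _ = eLpNorm (iteratedFDeriv ℝ 0 g) 2 μ := hnorm 0
      _ ≤ S := Finset.single_le_sum (f := fun j => eLpNorm (iteratedFDeriv ℝ j g) 2 μ)
          (fun _ _ => zero_le) (Finset.mem_range.2 (by norm_num))
  -- Leibniz: `‖D²h‖ ≤ 2A' Σ ‖D^{2-i} g'‖`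
  have hLeib : ∀ y, ‖iteratedFDeriv ℝ 2 h y‖ ≤
      2 * A' * ∑ i ∈ Finset.range 3, ‖iteratedFDeriv ℝ (2 - i) g' y‖ := by
    intro y
    calc ‖iteratedFDeriv ℝ 2 h y‖ ≤ ∑ i ∈ Finset.range (2 + 1), ((2 : ℕ).choose i : ℝ) *
          ‖iteratedFDeriv ℝ i φ y‖ * ‖iteratedFDeriv ℝ (2 - i) g' y‖ :=
          norm_iteratedFDeriv_smul_le (φ.contDiff (n := 2)) hg'c y le_rfl
      _ ≤ ∑ i ∈ Finset.range 3, 2 * A' * ‖iteratedFDeriv ℝ (2 - i) g' y‖ := by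
          refine Finset.sum_le_sum fun i hi => ?_
          have hchoose : ((2 : ℕ).choose i : ℝ) ≤ 2 := by
            have : (2 : ℕ).choose i ≤ 2 := by
              have hi' : i = 0 ∨ i = 1 ∨ i = 2 := by
                have := Finset.mem_range.1 hi; omega
              rcases hi' with rfl | rfl | rfl <;> decide
            exact_mod_cast this
          exact mul_le_mul_of_nonneg_right
            (mul_le_mul hchoose (hAi i hi y) (norm_nonneg _) zero_le_two) (norm_nonneg _)
      _ = _ := by rw [Finset.mul_sum]
  have hD2 : eLpNorm (iteratedFDeriv ℝ 2 h) 2 μ ≤ ENNReal.ofReal (2 * A') * S := by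
    calc eLpNorm (iteratedFDeriv ℝ 2 h) 2 μ
        ≤ eLpNorm (fun y => 2 * A' * ∑ i ∈ Finset.range 3, ‖iteratedFDeriv ℝ (2 - i) g' y‖) 2 μ :=
          eLpNorm_mono_real hLeib
      _ = ENNReal.ofReal (2 * A') *
            eLpNorm (∑ i ∈ Finset.range 3, fun y => ‖iteratedFDeriv ℝ (2 - i) g' y‖) 2 μ := by
          have : (fun y => 2 * A' * ∑ i ∈ Finset.range 3, ‖iteratedFDeriv ℝ (2 - i) g' y‖) =
              (2 * A') • ∑ i ∈ Finset.range 3, fun y => ‖iteratedFDeriv ℝ (2 - i) g' y‖ := by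
            ext y; simp only [Pi.smul_apply, Finset.sum_apply, smul_eq_mul]
          rw [this, eLpNorm_const_smul, Real.enorm_eq_ofReal (by positivity)]
      _ ≤ ENNReal.ofReal (2 * A') *
            ∑ i ∈ Finset.range 3, eLpNorm (fun y => ‖iteratedFDeriv ℝ (2 - i) g' y‖) 2 μ := by
          gcongr
          refine eLpNorm_sum_le (fun i _ => ?_) one_le_two
          have hle : ((2 - i : ℕ) : ℕ∞ω) ≤ 2 := by exact_mod_cast Nat.sub_le 2 i
          exact ((hg'c.continuous_iteratedFDeriv hle).norm).aestronglyMeasurable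
      _ = ENNReal.ofReal (2 * A') * S := by
          have hsum : ∑ i ∈ Finset.range 3,
              eLpNorm (fun y => ‖iteratedFDeriv ℝ (2 - i) g' y‖) 2 μ = S := by
            rw [hS, ← Finset.sum_range_reflect _ 3]
            refine Finset.sum_congr rfl fun i hi => ?_
            rw [eLpNorm_norm, hnorm]
            have h2i : 2 - (3 - 1 - i) = i := by
              have := Finset.mem_range.1 hi; omega
            rw [h2i]
          rw [hsum]
  calc ‖g x‖ₑ ≤ K₂ * (eLpNorm h 2 μ + eLpNorm (iteratedFDeriv ℝ 2 h) 2 μ) := hmain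
    _ ≤ K₂ * (S + ENNReal.ofReal (2 * A') * S) := by gcongr
    _ = K₂ * (1 + ENNReal.ofReal (2 * A')) * S := by ring

end DimThree

end Literature.Analysis.FunctionSpaces
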